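import Summits.MatrixMultiplication.OmegaCensus.SmallFormats.MatMul22nRankGF7Slack5PatDFS
import Summits.MatrixMultiplication.OmegaCensus.SmallFormats.MatMul22nRankGF7PackW
import Literature.NumberTheory.NumberFields.NFIsoNormPoly
import HarnessLib

/-!
# ω-census family (a): the invariant of the interval-pruned pattern search `pdfs5` and the heptad interval bounds

Cell `pub-omega` (unit `pub-omega-tensor-g16`), topic `Summits/MatrixMultiplication/OmegaCensus` (sub-folder `SmallFormats`).
Framing (verbatim): lottery ticket; floor = certified bounds/negative ranges. HONEST FRAMING: kernel infrastructure, step P1 of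
`pub-omega-tensor-g16/KERNEL-S5-DESIGN.md` (first half of the soundness proof of `MatMul22nRankGF7Slack5PatDFS`); nothing here is progress on `ω`.

After `k` steps the search state is `(ApackI5 P k, HpackI5 P k)` — the packed values of the assigned points and the packed heptad partial
sums (`HpackI5_eq`: digit `hb` = `hsum5 P k hb`, the sum of the values of the points of heptad `hb` assigned before step `k`); `hept_split5`:
the heptad identity split by assignment time, which yields the interval bounds used by `pcands5`.
-/

namespace Summit.MatrixMultiplication.OmegaCensus.SmallFormats

open Finset
open Literature.NumberTheory.NumberFields (list_sum_range_map)

/-! ## The inverse of the assignment order; heptad points are distinct -/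

/-- Step at which point `z` is assigned (`6`-bit fields). -/
def pOrdInv5 (z : ℕ) : ℕ :=
  ((List.range 42).map fun k => if pOrd5 k = z then k else 0).sum

set_option maxRecDepth 100000 in
/-- `pOrdInv5` inverts `pOrd5` on `[0, 42)`. -/
theorem pOrdInv5_ok : (∀ z : Fin 42, pOrdInv5 z.val < 42 ∧ pOrd5 (pOrdInv5 z.val) = z.val) ∧ ∀ k : Fin 42, pOrdInv5 (pOrd5 k.val) = k.val := by
  refine ⟨by decide, by decide⟩

set_option maxRecDepth 100000 in
/-- The 7 points of a heptad are pairwise distinct. -/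
theorem heptPt7_inj : ∀ y : Fin 8, ∀ b : Fin 6, ∀ t t' : Fin 7, heptPt7 y.val b.val t.val = heptPt7 y.val b.val t'.val → t = t' := by
  decide

/-! ## The invariant -/

/-- Packed values of the points assigned before step `k` (base 8, digit = point). -/
def ApackI5 (P : ℕ → ℕ) (k : ℕ) : ℕ := ∑ i ∈ range k, P (pOrd5 i) * 2 ^ (3 * pOrd5 i)
/-- The packed pattern (all 42 points): digit `z` = `P z`. -/
def packP5 (P : ℕ → ℕ) : ℕ := ApackI5 P 42
/-- Packed heptad partial sums after `k` steps, as the checker builds them. -/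
def HpackI5 (P : ℕ → ℕ) (k : ℕ) : ℕ := ∑ i ∈ range k, P (pOrd5 i) * pInc5 i
/-- Partial sum of heptad `hb` after `k` steps: the values of its points assigned before step `k`. -/
def hsum5 (P : ℕ → ℕ) (k hb : ℕ) : ℕ := ∑ t ∈ range 7, if pOrdInv5 (heptPt7 (hb / 6) (hb % 6) t) < k then P (heptPt7 (hb / 6) (hb % 6) t) else 0

/-- Step of the packed assignment. -/
theorem ApackI5_succ (P : ℕ → ℕ) (k : ℕ) : ApackI5 P (k + 1) = ApackI5 P k + P (pOrd5 k) * 2 ^ (3 * pOrd5 k) := by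
  unfold ApackI5; rw [sum_range_succ]
/-- Step of the packed partial sums. -/
theorem HpackI5_succ (P : ℕ → ℕ) (k : ℕ) : HpackI5 P (k + 1) = HpackI5 P k + P (pOrd5 k) * pInc5 k := by
  unfold HpackI5; rw [sum_range_succ]

/-- Digits of the packed assignment: `fld 3 (ApackI5 P k) (pOrd5 i) = P (pOrd5 i)` if `i < k`, else `0` (values `≤ 6`). -/
theorem fld_ApackI5 {s : ℕ} (hs : s ≤ 6) {P : ℕ → ℕ} (hP : ∀ z < 42, P z ≤ s) {k : ℕ} (hk : k ≤ 42) {i : ℕ} (hi : i < 42) :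
    fld 3 (ApackI5 P k) (pOrd5 i) = if i < k then P (pOrd5 i) else 0 := by
  obtain ⟨hinj, hlt, _, _⟩ := pOrd5_ok
  set g : ℕ → ℕ := fun z => if z ∈ (range k).image pOrd5 then P z else 0 with hg
  have himg : (range k).image pOrd5 ⊆ range 42 := by
    intro z hz; rw [mem_image] at hz; obtain ⟨a, ha, rfl⟩ := hz
    exact mem_range.2 (hlt ⟨a, by have := mem_range.1 ha; omega⟩)
  have hinj' : Set.InjOn pOrd5 ↑(range k) := by
    intro a ha b hb hab
    have := hinj ⟨a, by have := mem_range.1 (Finset.mem_coe.1 ha); omega⟩ ⟨b, by have := mem_range.1 (Finset.mem_coe.1 hb); omega⟩ hab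
    simpa using this
  have hA : ApackI5 P k = packW 3 g 42 := by
    unfold ApackI5 packW
    rw [← sum_image (f := fun z => P z * 2 ^ (3 * z)) hinj']
    rw [← sum_subset himg (fun z _ hz => by simp only [hg, if_neg hz, zero_mul])]
    refine sum_congr rfl fun z hz => ?_
    simp only [hg, if_pos hz]
  have hgl : ∀ z < 42, g z < 2 ^ 3 := by
    intro z hz; simp only [hg]; split_ifs <;> [have := hP z hz; skip] <;> omega
  rw [hA, fld_packW g hgl, if_pos (hlt ⟨i, hi⟩)]
  simp only [hg, mem_image, mem_range]
  by_cases hik : i < k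
  · rw [if_pos ⟨i, hik, rfl⟩, if_pos hik]
  · rw [if_neg, if_neg hik]
    rintro ⟨a, ha, hai⟩
    have := hinj ⟨a, by omega⟩ ⟨i, hi⟩ hai
    simp only [Fin.mk.injEq] at this
    omega

/-- Reading the pattern off its packing: `fld 3 (packP5 P) z = P z` (`z < 42`, values `≤ 6`). -/
theorem fld_packP5 {s : ℕ} (hs : s ≤ 6) {P : ℕ → ℕ} (hP : ∀ z < 42, P z ≤ s) {z : ℕ} (hz : z < 42) : fld 3 (packP5 P) z = P z := by
  obtain ⟨hi, he⟩ := pOrdInv5_ok.1 ⟨z, hz⟩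
  have h := fld_ApackI5 hs hP (le_refl 42) hi
  rw [if_pos hi] at h
  unfold packP5
  have he' : pOrd5 (pOrdInv5 z) = z := he
  rw [he'] at h
  exact h

/-- The increment mask is the packing of the indicator of the 8 heptads through the step point. -/
theorem pInc5_eq {k : ℕ} (hk : k < 42) :
    pInc5 k = packW 8 (fun hb => if hb ∈ (range 8).image (pHep5 k) then 1 else 0) 48 := by
  have hfacts := pHep5_ok ⟨k, hk⟩
  have hinj : Set.InjOn (pHep5 k) ↑(range 8) := by
    intro a ha b hb hab
    have := (hfacts ⟨a, mem_range.1 (Finset.mem_coe.1 ha)⟩).2.1 ⟨b, mem_range.1 (Finset.mem_coe.1 hb)⟩ hab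
    simpa using this
  have himg : (range 8).image (pHep5 k) ⊆ range 48 := by
    intro hb hhb; rw [mem_image] at hhb; obtain ⟨a, ha, rfl⟩ := hhb
    exact mem_range.2 (hfacts ⟨a, mem_range.1 ha⟩).1
  unfold pInc5 packW
  rw [list_sum_range_map, ← sum_image (f := fun hb => 2 ^ (8 * hb)) hinj,
    ← sum_subset himg (fun hb _ hhb => by simp only [if_neg hhb, zero_mul])]
  exact sum_congr rfl fun hb hhb => by simp only [if_pos hhb, one_mul]

/-- Membership of the step point in a heptad: `pOrd5 k` is a point of heptad `hb < 48` iff `hb` is one of the 8 listed heptads. -/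
theorem mem_hept_iff {k : ℕ} (hk : k < 42) {hb : ℕ} (hhb : hb < 48) :
    hb ∈ (range 8).image (pHep5 k) ↔ ∃ t < 7, heptPt7 (hb / 6) (hb % 6) t = pOrd5 k := by
  constructor
  · intro h
    rw [mem_image] at h
    obtain ⟨j, hj, rfl⟩ := h
    have hone : ((List.range 7).filter fun t => heptPt7 (pHep5 k j / 6) (pHep5 k j % 6) t = pOrd5 k).length = 1 :=
      (pHep5_ok ⟨k, hk⟩ ⟨j, mem_range.1 hj⟩).2.2.1
    by_contra hne
    have h0 : ((List.range 7).filter fun t => heptPt7 (pHep5 k j / 6) (pHep5 k j % 6) t = pOrd5 k).length = 0 := by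
      rw [List.length_eq_zero_iff, List.filter_eq_nil_iff]
      intro t ht
      simp only [decide_eq_true_eq]
      intro heq
      exact hne ⟨t, List.mem_range.1 ht, heq⟩
    omega
  · rintro ⟨t, ht, hpt⟩
    obtain ⟨i, hi⟩ := pHep5_complete ⟨k, hk⟩ ⟨hb / 6, by omega⟩ ⟨hb % 6, Nat.mod_lt _ (by norm_num)⟩ ⟨t, ht⟩ hpt
    rw [mem_image]
    refine ⟨i.val, mem_range.2 i.isLt, ?_⟩
    have hi' : pHep5 k i.val = 6 * (hb / 6) + hb % 6 := hi
    rw [hi']; omega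

/-- Number of points of heptad `hb` equal to the step point: `1` if the heptad passes through it, else `0`. -/
theorem card_hept_pt {k : ℕ} (hk : k < 42) {hb : ℕ} (hhb : hb < 48) :
    ((range 7).filter fun t => heptPt7 (hb / 6) (hb % 6) t = pOrd5 k).card = if hb ∈ (range 8).image (pHep5 k) then 1 else 0 := by
  by_cases h : hb ∈ (range 8).image (pHep5 k)
  · rw [if_pos h]
    obtain ⟨t, ht, hpt⟩ := (mem_hept_iff hk hhb).1 h
    rw [card_eq_one]
    refine ⟨t, ?_⟩
    ext t'
    rw [mem_filter, mem_range, mem_singleton]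
    constructor
    · rintro ⟨ht', hpt'⟩
      have := heptPt7_inj ⟨hb / 6, by omega⟩ ⟨hb % 6, Nat.mod_lt _ (by norm_num)⟩ ⟨t', ht'⟩ ⟨t, ht⟩ (hpt'.trans hpt.symm)
      simpa using this
    · rintro rfl; exact ⟨ht, hpt⟩
  · rw [if_neg h, card_eq_zero, filter_eq_empty_iff]
    intro t ht hpt
    exact h ((mem_hept_iff hk hhb).2 ⟨t, mem_range.1 ht, hpt⟩)

/-- Step of the partial sums: the step point adds its value to exactly its 8 heptads. -/
theorem hsum5_succ (P : ℕ → ℕ) {k : ℕ} (hk : k < 42) {hb : ℕ} (hhb : hb < 48) :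
    hsum5 P (k + 1) hb = hsum5 P k hb + (if hb ∈ (range 8).image (pHep5 k) then 1 else 0) * P (pOrd5 k) := by
  obtain ⟨hinv1, hinv2⟩ := pOrdInv5_ok
  unfold hsum5
  have e : ∀ t ∈ range 7, (if pOrdInv5 (heptPt7 (hb / 6) (hb % 6) t) < k + 1 then P (heptPt7 (hb / 6) (hb % 6) t) else 0)
      = (if pOrdInv5 (heptPt7 (hb / 6) (hb % 6) t) < k then P (heptPt7 (hb / 6) (hb % 6) t) else 0)
        + (if heptPt7 (hb / 6) (hb % 6) t = pOrd5 k then P (pOrd5 k) else 0) := by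
    intro t ht
    have hpt : heptPt7 (hb / 6) (hb % 6) t < 42 := heptPt7_lt ⟨hb / 6, by omega⟩ ⟨hb % 6, Nat.mod_lt _ (by norm_num)⟩ ⟨t, mem_range.1 ht⟩
    by_cases heq : heptPt7 (hb / 6) (hb % 6) t = pOrd5 k
    · rw [if_pos heq, heq]
      have : pOrdInv5 (pOrd5 k) = k := hinv2 ⟨k, hk⟩
      rw [this, if_pos (by omega), if_neg (by omega)]; simp
    · rw [if_neg heq, add_zero]
      have hne : pOrdInv5 (heptPt7 (hb / 6) (hb % 6) t) ≠ k := by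
        intro hc
        have := (hinv1 ⟨_, hpt⟩).2
        rw [hc] at this
        exact heq this.symm
      by_cases hlt : pOrdInv5 (heptPt7 (hb / 6) (hb % 6) t) < k
      · rw [if_pos (by omega), if_pos hlt]
      · rw [if_neg (by omega), if_neg hlt]
  rw [sum_congr rfl e, sum_add_distrib]
  congr 1
  have e2 : ∀ t ∈ range 7, (if heptPt7 (hb / 6) (hb % 6) t = pOrd5 k then P (pOrd5 k) else 0)
      = (if heptPt7 (hb / 6) (hb % 6) t = pOrd5 k then 1 else 0) * P (pOrd5 k) := by
    intro t _; split_ifs <;> simp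
  rw [sum_congr rfl e2, ← sum_mul, ← card_filter, card_hept_pt hk hhb]

/-- **The packed partial sums are the packing of `hsum5`.** -/
theorem HpackI5_eq (P : ℕ → ℕ) {k : ℕ} (hk : k ≤ 42) : HpackI5 P k = packW 8 (hsum5 P k) 48 := by
  induction k with
  | zero =>
    unfold HpackI5 packW hsum5
    simp
  | succ k ih =>
    rw [HpackI5_succ, ih (by omega), pInc5_eq (by omega), ← packW_smul, ← packW_add]
    exact packW_congr 8 fun hb hhb => by
      show hsum5 P k hb + P (pOrd5 k) * (if hb ∈ (range 8).image (pHep5 k) then 1 else 0) = hsum5 P (k + 1) hb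
      rw [hsum5_succ P (by omega) hhb]; ring

/-- A partial sum is at most the full heptad sum `6s`. -/
theorem hsum5_le {s : ℕ} {P : ℕ → ℕ} (hP : IsPat7 s P) (k : ℕ) {hb : ℕ} (hhb : hb < 48) : hsum5 P k hb ≤ 6 * s := by
  rw [← hP.2 (hb / 6) (by omega) (hb % 6) (Nat.mod_lt _ (by norm_num))]
  unfold hsum5
  exact sum_le_sum fun t _ => by split_ifs <;> omega

/-- Digits of the packed partial sums (`s ≤ 6`). -/
theorem fld_HpackI5 {s : ℕ} (hs : s ≤ 6) {P : ℕ → ℕ} (hP : IsPat7 s P) {k : ℕ} (hk : k ≤ 42) {hb : ℕ} (hhb : hb < 48) :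
    fld 8 (HpackI5 P k) hb = hsum5 P k hb := by
  rw [HpackI5_eq P hk, fld_packW _ (fun i hi => by have := hsum5_le hP k hi; omega), if_pos hhb]

/-! ## The bounds -/

/-- `foldr max` is below a bound iff every element is. -/
theorem foldr_max_le_iff (l : List ℕ) (a v : ℕ) : l.foldr max a ≤ v ↔ a ≤ v ∧ ∀ x ∈ l, x ≤ v := by
  induction l with
  | nil => simp
  | cons x l ih => simp only [List.foldr_cons, max_le_iff, List.mem_cons, forall_eq_or_imp, ih]; tauto

/-- A bound is below `foldr min` iff it is below every element. -/
theorem le_foldr_min_iff (l : List ℕ) (a v : ℕ) : v ≤ l.foldr min a ↔ v ≤ a ∧ ∀ x ∈ l, v ≤ x := by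
  induction l with
  | nil => simp
  | cons x l ih => simp only [List.foldr_cons, le_min_iff, List.mem_cons, forall_eq_or_imp, ih]; tauto

/-- Converting a `List.filter` length over `List.range 7` into a `Finset` cardinality. -/
theorem filter_len7b (p : ℕ → Bool) : ((List.range 7).filter p).length = ((range 7).filter fun t => p t = true).card := by
  have e : ((range 7).filter fun t => p t = true) = ((List.range 7).filter p).toFinset := by ext t; simp
  rw [e, List.card_toFinset, List.Nodup.dedup (List.Nodup.filter _ List.nodup_range)]

set_option maxHeartbeats 1600000 in
/-- The heptad identity at step `k` split by assignment time: for a heptad `hb = pHep5 k j` through the step point,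
`6s = (partial sum) + P (step point) + (sum over the r = 6 − pCnt5 k j points assigned later)`, the later values lying in `[m, s]`. -/
theorem hept_split5 {s : ℕ} {P : ℕ → ℕ} (hP : IsPat7 s P) {m : ℕ} (hm : ∀ z < 42, m ≤ P z) {k : ℕ} (hk : k < 42) {j : ℕ} (hj : j < 8) :
    hsum5 P k (pHep5 k j) + P (pOrd5 k) + (6 - pCnt5 k j) * m ≤ 6 * s ∧
      6 * s ≤ hsum5 P k (pHep5 k j) + P (pOrd5 k) + (6 - pCnt5 k j) * s := by
  obtain ⟨hinv1, hinv2⟩ := pOrdInv5_ok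
  obtain ⟨hhb, _, hone, hcnt⟩ := pHep5_ok ⟨k, hk⟩ ⟨j, hj⟩
  have hhb' : pHep5 k j < 48 := hhb
  have hone' : ((List.range 7).filter fun t => heptPt7 (pHep5 k j / 6) (pHep5 k j % 6) t = pOrd5 k).length = 1 := hone
  have hcnt' : ((List.range 7).filter fun t =>
      (List.range k).any fun k' => pOrd5 k' = heptPt7 (pHep5 k j / 6) (pHep5 k j % 6) t).length = pCnt5 k j := hcnt
  generalize pHep5 k j = hb at hhb' hone' hcnt' ⊢
  have hy : hb / 6 < 8 := by omega
  have hb6 : hb % 6 < 6 := Nat.mod_lt _ (by norm_num)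
  have hptlt : ∀ t < 7, heptPt7 (hb / 6) (hb % 6) t < 42 := fun t ht => heptPt7_lt ⟨hb / 6, hy⟩ ⟨hb % 6, hb6⟩ ⟨t, ht⟩
  have hsum : ∑ t ∈ range 7, P (heptPt7 (hb / 6) (hb % 6) t) = 6 * s := hP.2 _ hy _ hb6
  have hpos_eq : ∀ t < 7, pOrdInv5 (heptPt7 (hb / 6) (hb % 6) t) = k ↔ heptPt7 (hb / 6) (hb % 6) t = pOrd5 k := by
    intro t ht
    constructor
    · intro h; have := (hinv1 ⟨_, hptlt t ht⟩).2; rw [h] at this; exact this.symm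
    · intro h; rw [h]; exact hinv2 ⟨k, hk⟩
  -- pointwise trichotomy: before / equal / after
  have hval : ∀ t ∈ range 7, P (heptPt7 (hb / 6) (hb % 6) t)
      = (if pOrdInv5 (heptPt7 (hb / 6) (hb % 6) t) < k then P (heptPt7 (hb / 6) (hb % 6) t) else 0)
        + (if heptPt7 (hb / 6) (hb % 6) t = pOrd5 k then 1 else 0) * P (pOrd5 k)
        + (if k < pOrdInv5 (heptPt7 (hb / 6) (hb % 6) t) then P (heptPt7 (hb / 6) (hb % 6) t) else 0) := by
    intro t ht
    have ht7 := mem_range.1 ht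
    have hiff := hpos_eq t ht7
    rcases Nat.lt_trichotomy (pOrdInv5 (heptPt7 (hb / 6) (hb % 6) t)) k with h | h | h
    · rw [if_pos h, if_neg (fun he => by rw [hiff.2 he] at h; omega), if_neg (by omega)]; simp
    · rw [if_neg (by omega), if_pos (hiff.1 h), if_neg (by omega), ← hiff.1 h]; simp
    · rw [if_neg (by omega), if_neg (fun he => by rw [hiff.2 he] at h; omega), if_pos h]; simp
  have hone1 : ∀ t ∈ range 7, (1 : ℕ) = (if pOrdInv5 (heptPt7 (hb / 6) (hb % 6) t) < k then 1 else 0)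
        + (if heptPt7 (hb / 6) (hb % 6) t = pOrd5 k then 1 else 0)
        + (if k < pOrdInv5 (heptPt7 (hb / 6) (hb % 6) t) then 1 else 0) := by
    intro t ht
    have ht7 := mem_range.1 ht
    have hiff := hpos_eq t ht7
    rcases Nat.lt_trichotomy (pOrdInv5 (heptPt7 (hb / 6) (hb % 6) t)) k with h | h | h
    · rw [if_pos h, if_neg (fun he => by rw [hiff.2 he] at h; omega), if_neg (by omega)]
    · rw [if_neg (by omega), if_pos (hiff.1 h), if_neg (by omega)]
    · rw [if_neg (by omega), if_neg (fun he => by rw [hiff.2 he] at h; omega), if_pos h]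
  -- the counts
  have cE : ∑ t ∈ range 7, (if heptPt7 (hb / 6) (hb % 6) t = pOrd5 k then 1 else 0) = 1 := by
    have h := filter_len7b (fun t => decide (heptPt7 (hb / 6) (hb % 6) t = pOrd5 k))
    rw [hone'] at h
    rw [← card_filter, h]
    congr 1
    exact filter_congr fun t _ => by rw [decide_eq_true_iff]
  have cB : ∑ t ∈ range 7, (if pOrdInv5 (heptPt7 (hb / 6) (hb % 6) t) < k then 1 else 0) = pCnt5 k j := by
    have h := filter_len7b (fun t => (List.range k).any fun k' => pOrd5 k' = heptPt7 (hb / 6) (hb % 6) t)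
    rw [hcnt'] at h
    rw [← card_filter, h]
    congr 1
    apply filter_congr
    intro t ht
    have ht7 := mem_range.1 ht
    rw [List.any_eq_true]
    constructor
    · intro h
      refine ⟨pOrdInv5 (heptPt7 (hb / 6) (hb % 6) t), List.mem_range.2 h, ?_⟩
      rw [decide_eq_true_eq]; exact (hinv1 ⟨_, hptlt t ht7⟩).2
    · rintro ⟨k', hk', he⟩
      rw [decide_eq_true_eq] at he
      have hk'k := List.mem_range.1 hk'
      rw [← he, hinv2 ⟨k', by omega⟩]; exact hk'k
  have c7 : (7 : ℕ) = pCnt5 k j + 1 + ∑ t ∈ range 7, (if k < pOrdInv5 (heptPt7 (hb / 6) (hb % 6) t) then 1 else 0) := by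
    have h := sum_congr rfl hone1
    rw [sum_const, card_range, smul_eq_mul, mul_one, sum_add_distrib, sum_add_distrib, cE, cB] at h
    exact h
  -- the sums
  have hS := sum_congr rfl hval
  rw [hsum, sum_add_distrib, sum_add_distrib, ← sum_mul, cE, one_mul] at hS
  have hB : ∑ t ∈ range 7, (if pOrdInv5 (heptPt7 (hb / 6) (hb % 6) t) < k then P (heptPt7 (hb / 6) (hb % 6) t) else 0) = hsum5 P k hb := rfl
  rw [hB] at hS
  have hA_lo : (∑ t ∈ range 7, (if k < pOrdInv5 (heptPt7 (hb / 6) (hb % 6) t) then 1 else 0)) * m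
      ≤ ∑ t ∈ range 7, (if k < pOrdInv5 (heptPt7 (hb / 6) (hb % 6) t) then P (heptPt7 (hb / 6) (hb % 6) t) else 0) := by
    rw [sum_mul]
    exact sum_le_sum fun t ht => by
      split_ifs with h
      · rw [one_mul]; exact hm _ (hptlt t (mem_range.1 ht))
      · simp
  have hA_hi : ∑ t ∈ range 7, (if k < pOrdInv5 (heptPt7 (hb / 6) (hb % 6) t) then P (heptPt7 (hb / 6) (hb % 6) t) else 0)
      ≤ (∑ t ∈ range 7, (if k < pOrdInv5 (heptPt7 (hb / 6) (hb % 6) t) then 1 else 0)) * s := by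
    rw [sum_mul]
    exact sum_le_sum fun t ht => by
      split_ifs with h
      · rw [one_mul]; exact hP.1 _ (hptlt t (mem_range.1 ht))
      · simp
  generalize (∑ t ∈ range 7, (if k < pOrdInv5 (heptPt7 (hb / 6) (hb % 6) t) then 1 else 0)) = ca at c7 hA_lo hA_hi
  generalize (∑ t ∈ range 7, (if k < pOrdInv5 (heptPt7 (hb / 6) (hb % 6) t) then P (heptPt7 (hb / 6) (hb % 6) t) else 0)) = A
    at hS hA_lo hA_hi
  have hca : ca = 6 - pCnt5 k j := by omega
  subst hca
  constructor
  · nlinarith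
  · nlinarith

end Summit.MatrixMultiplication.OmegaCensus.SmallFormats
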